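import Mathlib
import Summits.CriticalPhenomena.PercolationContinuityZ3.Theorems.PercNearOneGluingNoHeavyLowerTailStarLemma

/-!
# Crux `PercNearOneGluing.NoHeavyLowerTail` (stmt-CriticalPhenomena-4575), line `bhk-superadditivity-thinning` —
# the Star Lemma with MAXIMAL charging (stub `starLemma_maxCharge`)

Lead `prover-line-stmt-CriticalPhenomena-4575-c3-0`, 2026-08-16; lands with `--supports stmt-CriticalPhenomena-4575`.

`starLemma` (file `PercNearOneGluingNoHeavyLowerTailStarLemma`) bounds the bad mass
`Σ_ω p ω (∏_{i<k} (1 - q i 1{i ∈ L ω}) - ∏_{i<k} (1 - q i))` of a finitely supported nonnegative law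
of alive sets `L ω` with independent entrance coins `q i ∈ [0,1]` by the hit-weighted sum
`Σ_{j<k} q j ∏_{j<i<k} (1 - q i) · r j` of the unreliabilities `r j` (priority to LARGER INDICES), as
soon as the deadness `Σ_ω p ω 1{j ∉ L ω}` is non-decreasing in `j`.  Here the charging is upgraded to
the MAXIMAL one ("MAXD for star-attached observers"): the bad mass is at most
`E[max over open coins j of r j ; some coin open] = Σ_{j<k} q j ∏_{i<k, i beats j} (1 - q i) · r j`,
where `i` beats `j` iff `r j < r i ∨ (r j = r i ∧ j < i)` (a strict total order on the units).

The proof is `starLemma` followed by the purely deterministic REARRANGEMENT inequality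
`starLemma_maxCharge_rearrange`: for arbitrary reals `r j` and coins `q j ∈ [0,1]`,
`Σ_{j<k} q j ∏_{j<i<k} (1 - q i) · r j ≤ Σ_{j<k} q j ∏_{i<k, i beats j} (1 - q i) · r j`
(the value at the largest open index is at most the largest open value).  It is proved by induction on
`k`: peeling the top unit `k`, both sides satisfy `X(k+1) = (1 - q k) X(k) + q k · (…)`, and the step
reduces, on the upper set `A = {j < k | r k < r j}`, to the telescoping identity
`Σ_{j ∈ A} q j ∏_{i ∈ A, i beats j} (1 - q i) = 1 - ∏_{i ∈ A} (1 - q i)`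
(`starLemma_maxCharge_hitWeight_sum`, induction along the `beats` order via
`Finset.induction_on_max_value` with the lexicographic key `(r i, i)`).
-/

namespace Summit.CriticalPhenomena.PercolationContinuityZ3.Theorems

open Finset

open scoped BigOperators

/-- **Telescoping identity for the `beats` order.**  For values `r` and coins `q` on a finite set `A`
of units, where `i` beats `j` iff `r j < r i ∨ (r j = r i ∧ j < i)`, the maximal-charging hit weights
`q j ∏_{i ∈ A, i beats j} (1 - q i)` sum over `j ∈ A` to `1 - ∏_{i ∈ A} (1 - q i)`
(some coin of `A` is open iff there is a `beats`-largest open coin).  Pure algebra, no sign conditions. -/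
theorem starLemma_maxCharge_hitWeight_sum (r q : ℕ → ℝ) (A : Finset ℕ) :
    ∑ j ∈ A, (q j) * Finset.prod (A.filter (fun i => r j < r i ∨ (r j = r i ∧ j < i))) (fun i => (1 : ℝ) - q i)
      = 1 - Finset.prod A (fun i => (1 : ℝ) - q i) := by
  induction A using Finset.induction_on_max_value (fun i => toLex (r i, i)) with
  | empty => simp
  | insert a s has hmax ih =>
    -- `a` beats every `x ∈ s`
    have hbeat : ∀ x ∈ s, r x < r a ∨ (r x = r a ∧ x < a) := by
      intro x hx
      have hxa : x ≠ a := fun h => has (h ▸ hx)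
      rcases (Prod.Lex.toLex_le_toLex.1 (hmax x hx)) with h | ⟨h1, h2⟩
      · exact Or.inl h
      · exact Or.inr ⟨h1, lt_of_le_of_ne h2 hxa⟩
    -- nothing in `insert a s` beats `a`
    have hfa : (insert a s).filter (fun i => r a < r i ∨ (r a = r i ∧ a < i)) = ∅ := by
      refine Finset.filter_false_of_mem fun i hi => ?_
      rcases Finset.mem_insert.1 hi with rfl | hi
      · rintro (h | ⟨_, h⟩) <;> exact lt_irrefl _ h
      · rcases hbeat i hi with h | ⟨h1, h2⟩
        · rintro (h' | ⟨h', _⟩)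
          · exact lt_asymm h h'
          · exact h.ne h'.symm
        · rintro (h' | ⟨_, h'⟩)
          · exact h'.ne h1.symm
          · exact lt_asymm h2 h'
    have hsum : ∑ j ∈ s, (q j) * Finset.prod ((insert a s).filter (fun i => r j < r i ∨ (r j = r i ∧ j < i))) (fun i => (1 : ℝ) - q i)
        = (1 - q a) * ∑ j ∈ s, (q j) * Finset.prod (s.filter (fun i => r j < r i ∨ (r j = r i ∧ j < i))) (fun i => (1 : ℝ) - q i) := by
      rw [Finset.mul_sum]
      refine Finset.sum_congr rfl fun j hj => ?_
      have hnot : a ∉ s.filter (fun i => r j < r i ∨ (r j = r i ∧ j < i)) :=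
        fun h => has (Finset.mem_filter.1 h).1
      rw [Finset.filter_insert, if_pos (hbeat j hj), Finset.prod_insert hnot]
      ring
    rw [Finset.sum_insert has, hfa, Finset.prod_empty, mul_one, hsum, ih, Finset.prod_insert has]
    ring

/-- Adding the unit `k` on top of `0, …, k-1`: among `0, …, k` the units beating `k` are the old units
of strictly larger value. -/
theorem starLemma_maxCharge_filter_succ_self (r : ℕ → ℝ) (k : ℕ) :
    (Finset.range (k + 1)).filter (fun i => r k < r i ∨ (r k = r i ∧ k < i))
      = (Finset.range k).filter (fun i => r k < r i) := by
  ext i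
  simp only [Finset.mem_filter, Finset.mem_range]
  constructor
  · rintro ⟨hi, h | ⟨_, h⟩⟩
    · refine ⟨lt_of_le_of_ne (Nat.lt_succ_iff.1 hi) ?_, h⟩
      rintro rfl
      exact lt_irrefl _ h
    · exact absurd (Nat.lt_succ_iff.1 hi) (not_le.2 h)
  · rintro ⟨hi, h⟩
    exact ⟨Nat.lt_succ_of_lt hi, Or.inl h⟩

/-- Adding the unit `k` on top of `0, …, k-1`: for an old unit `j < k`, the new unit `k` beats `j`
unless `r k < r j`. -/
theorem starLemma_maxCharge_filter_succ_of_lt (r : ℕ → ℝ) {k j : ℕ} (hj : j < k) :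
    (Finset.range (k + 1)).filter (fun i => r j < r i ∨ (r j = r i ∧ j < i))
      = if r k < r j then (Finset.range k).filter (fun i => r j < r i ∨ (r j = r i ∧ j < i))
        else insert k ((Finset.range k).filter (fun i => r j < r i ∨ (r j = r i ∧ j < i))) := by
  rw [Finset.range_add_one, Finset.filter_insert]
  by_cases h : r k < r j
  · rw [if_pos h, if_neg]
    rintro (h' | ⟨h', _⟩)
    · exact lt_asymm h h'
    · exact h.ne' h'
  · rw [if_neg h, if_pos]
    rcases lt_or_eq_of_le (not_lt.1 h) with h' | h'
    · exact Or.inl h'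
    · exact Or.inr ⟨h', hj⟩

/-- **Rearrangement inequality (index priority ≤ maximal charging).**  For arbitrary reals `r j` and
coins `q j ∈ [0,1]`, the hit-weighted sum with priority to larger indices,
`Σ_{j<k} q j ∏_{j<i<k} (1 - q i) · r j` (= `E[r at the largest open index; some coin open]`), is at
most the one with priority to larger values, `Σ_{j<k} q j ∏_{i<k, i beats j} (1 - q i) · r j`
(= `E[max of r over the open coins; some coin open]`). -/
theorem starLemma_maxCharge_rearrange (r q : ℕ → ℝ) (hq0 : ∀ j, 0 ≤ q j) (hq1 : ∀ j, q j ≤ 1)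
    (k : ℕ) :
    ∑ j ∈ Finset.range k, ((q j) * Finset.prod (Finset.Ico (j + 1) k) (fun i => (1 : ℝ) - q i)) * r j
      ≤ ∑ j ∈ Finset.range k, ((q j) * Finset.prod ((Finset.range k).filter (fun i => r j < r i ∨ (r j = r i ∧ j < i))) (fun i => (1 : ℝ) - q i)) * r j := by
  induction k with
  | zero => simp
  | succ k ih =>
    have hqk0 := hq0 k
    have hqk1 : 0 ≤ 1 - q k := by linarith [hq1 k]
    -- recursion for the index-priority side
    have hL : ∑ j ∈ Finset.range (k + 1), ((q j) * Finset.prod (Finset.Ico (j + 1) (k + 1)) (fun i => (1 : ℝ) - q i)) * r j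
        = (1 - q k) * ∑ j ∈ Finset.range k, ((q j) * Finset.prod (Finset.Ico (j + 1) k) (fun i => (1 : ℝ) - q i)) * r j
          + q k * r k := by
      rw [Finset.sum_range_succ, slW_succ_self, Finset.mul_sum]
      congr 1
      refine Finset.sum_congr rfl fun j hj => ?_
      rw [slW_succ_of_lt q (Finset.mem_range.1 hj)]
      ring
    -- recursion for the maximal-charging side; `A = {j < k | r k < r j}` is the upper set of `k`
    have hR : ∑ j ∈ Finset.range (k + 1), ((q j) * Finset.prod ((Finset.range (k + 1)).filter (fun i => r j < r i ∨ (r j = r i ∧ j < i))) (fun i => (1 : ℝ) - q i)) * r j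
        = (1 - q k) * ∑ j ∈ Finset.range k, ((q j) * Finset.prod ((Finset.range k).filter (fun i => r j < r i ∨ (r j = r i ∧ j < i))) (fun i => (1 : ℝ) - q i)) * r j
          + q k * ∑ j ∈ (Finset.range k).filter (fun j => r k < r j), ((q j) * Finset.prod ((Finset.range k).filter (fun i => r j < r i ∨ (r j = r i ∧ j < i))) (fun i => (1 : ℝ) - q i)) * r j
          + ((q k) * Finset.prod ((Finset.range k).filter (fun i => r k < r i)) (fun i => (1 : ℝ) - q i)) * r k := by
      rw [Finset.sum_range_succ, starLemma_maxCharge_filter_succ_self]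
      congr 1
      rw [Finset.sum_filter, Finset.mul_sum, Finset.mul_sum, ← Finset.sum_add_distrib]
      refine Finset.sum_congr rfl fun j hj => ?_
      have hjk : j < k := Finset.mem_range.1 hj
      rw [starLemma_maxCharge_filter_succ_of_lt r hjk]
      by_cases h : r k < r j
      · rw [if_pos h, if_pos h]
        ring
      · have hnot : k ∉ (Finset.range k).filter (fun i => r j < r i ∨ (r j = r i ∧ j < i)) := by simp
        rw [if_neg h, if_neg h, Finset.prod_insert hnot]
        ring
    -- the key estimate on the upper set
    have hkey : (1 - Finset.prod ((Finset.range k).filter (fun i => r k < r i)) (fun i => (1 : ℝ) - q i)) * r k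
        ≤ ∑ j ∈ (Finset.range k).filter (fun j => r k < r j), ((q j) * Finset.prod ((Finset.range k).filter (fun i => r j < r i ∨ (r j = r i ∧ j < i))) (fun i => (1 : ℝ) - q i)) * r j := by
      -- for `j ∈ A`, everything beating `j` lies in `A`
      have hfilt : ∀ j ∈ (Finset.range k).filter (fun j => r k < r j),
          (Finset.range k).filter (fun i => r j < r i ∨ (r j = r i ∧ j < i))
            = ((Finset.range k).filter (fun i => r k < r i)).filter (fun i => r j < r i ∨ (r j = r i ∧ j < i)) := by
        intro j hj
        have hrj : r k < r j := (Finset.mem_filter.1 hj).2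
        ext i
        simp only [Finset.mem_filter, Finset.mem_range]
        constructor
        · rintro ⟨hi, h⟩
          refine ⟨⟨hi, ?_⟩, h⟩
          rcases h with h | ⟨h, _⟩
          · exact hrj.trans h
          · exact hrj.trans_eq h
        · rintro ⟨⟨hi, _⟩, h⟩
          exact ⟨hi, h⟩
      calc (1 - Finset.prod ((Finset.range k).filter (fun i => r k < r i)) (fun i => (1 : ℝ) - q i)) * r k
          = (∑ j ∈ (Finset.range k).filter (fun i => r k < r i), (q j) * Finset.prod (((Finset.range k).filter (fun i => r k < r i)).filter (fun i => r j < r i ∨ (r j = r i ∧ j < i))) (fun i => (1 : ℝ) - q i)) * r k := by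
            rw [starLemma_maxCharge_hitWeight_sum r q]
        _ = ∑ j ∈ (Finset.range k).filter (fun i => r k < r i), ((q j) * Finset.prod (((Finset.range k).filter (fun i => r k < r i)).filter (fun i => r j < r i ∨ (r j = r i ∧ j < i))) (fun i => (1 : ℝ) - q i)) * r k := by
            rw [Finset.sum_mul]
        _ ≤ ∑ j ∈ (Finset.range k).filter (fun i => r k < r i), ((q j) * Finset.prod (((Finset.range k).filter (fun i => r k < r i)).filter (fun i => r j < r i ∨ (r j = r i ∧ j < i))) (fun i => (1 : ℝ) - q i)) * r j := by
            refine Finset.sum_le_sum fun j hj => ?_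
            have hrj : r k < r j := (Finset.mem_filter.1 hj).2
            refine mul_le_mul_of_nonneg_left hrj.le ?_
            refine mul_nonneg (hq0 j) (Finset.prod_nonneg fun i _ => ?_)
            linarith [hq1 i]
        _ = ∑ j ∈ (Finset.range k).filter (fun j => r k < r j), ((q j) * Finset.prod ((Finset.range k).filter (fun i => r j < r i ∨ (r j = r i ∧ j < i))) (fun i => (1 : ℝ) - q i)) * r j := by
            refine Finset.sum_congr rfl fun j hj => ?_
            rw [hfilt j hj]
    -- assemble
    rw [hL, hR]
    have hih := mul_le_mul_of_nonneg_left ih hqk1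
    have hkey' := mul_le_mul_of_nonneg_left hkey hqk0
    linarith [hih, hkey']

/-- **The Star Lemma with maximal charging** (stub `starLemma_maxCharge` of stmt-CriticalPhenomena-4575;
law-level form of "MAXD for star-attached observers").  In the setting of `starLemma` — a finitely
supported nonnegative law `(s, p)` of alive sets `L ω ⊆ ℕ`, independent entrance coins `q j ∈ [0,1]` on
the units `0, …, k-1`, deadness `Σ_ω p ω 1{j ∉ L ω}` non-decreasing in `j` — the bad mass
`Σ_ω p ω (∏_{i<k} (1 - q i 1{i ∈ L ω}) - ∏_{i<k} (1 - q i))` is at most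
`Σ_{j<k} q j ∏_{i<k, i beats j} (1 - q i) · r j`, the expectation of the LARGEST unreliability
`r j = Σ_ω p ω 1{j ∉ L ω} (1 - q j (1 - ∏_{i<k} (1 - q i 1{i ∈ L ω})))` among the open coins
(`i` beats `j` iff `r j < r i ∨ (r j = r i ∧ j < i)`).  Proof: `starLemma` and the rearrangement
inequality `starLemma_maxCharge_rearrange`. -/
theorem starLemma_maxCharge : ∀ {Ω : Type*} (s : Finset Ω) (p : Ω → ℝ), (∀ ω ∈ s, 0 ≤ p ω) → ∀ (L : Ω → Finset ℕ) (q : ℕ → ℝ), (∀ j, 0 ≤ q j) → (∀ j, q j ≤ 1) → ∀ (k : ℕ), (∀ i j, i ≤ j → j < k → (Finset.sum s (fun ω => p ω * (if i ∈ L ω then (0 : ℝ) else 1))) ≤ (Finset.sum s (fun ω => p ω * (if j ∈ L ω then (0 : ℝ) else 1)))) → (Finset.sum s (fun ω => p ω * ((Finset.prod (Finset.range k) (fun i => if i ∈ (L ω) then (1 : ℝ) - q i else 1)) - (Finset.prod (Finset.range k) (fun i => (1 : ℝ) - q i))))) ≤ ∑ j ∈ Finset.range k, ((q j) * Finset.prod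 ((Finset.range k).filter (fun i => (Finset.sum s (fun ω => p ω * (if j ∈ L ω then (0 : ℝ) else 1 - (q j) * (1 - (Finset.prod (Finset.range k) (fun i' => if i' ∈ (L ω) then (1 : ℝ) - q i' else 1)))))) < (Finset.sum s (fun ω => p ω * (if i ∈ L ω then (0 : ℝ) else 1 - (q i) * (1 - (Finset.prod (Finset.range k) (fun i' => if i' ∈ (L ω) then (1 : ℝ) - q i' else 1)))))) ∨ ((Finset.sum s (fun ω => p ω * (if j ∈ L ω then (0 : ℝ) else 1 - (q j) * (1 - (Finset.prod (Finset.range k) (fun i' => if i' ∈ (L ω) then (1 : ℝ) - q i' else 1)))))) = (Finset.sum s (fun ω => p ω * (if i ∈ L ω then (0 : ℝ) else 1 - (q i) * (1 - (Finset.prod (Finset.range k) (fun i' => if i' ∈ (L ω) then (1 : ℝ) - q i' else 1)))))) ∧ j < i))) (fun i => (1 : ℝ) - q i)) * (Finset.sum s (fun ω => p ω * (if j ∈ L ω then (0 : ℝ) else 1 - (q j) * (1 - (Finset.prod (Finset.range k) (fun i => if i ∈ (L ω) then (1 : ℝ) - q i else 1)))))) := by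
  intro Ω s p hp L q hq0 hq1 k hmono
  refine le_trans (starLemma s p hp L q hq0 hq1 k hmono) ?_
  exact starLemma_maxCharge_rearrange (fun j => Finset.sum s (fun ω => p ω * (if j ∈ L ω then (0 : ℝ) else 1 - (q j) * (1 - (Finset.prod (Finset.range k) (fun i => if i ∈ (L ω) then (1 : ℝ) - q i else 1)))))) q hq0 hq1 k

end Summit.CriticalPhenomena.PercolationContinuityZ3.Theorems
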